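import Summits.QuantumFields.YangMills.Theorems.ColdStartUniversalityLatticeLangevinReverseLocalPoincareFlow
import HarnessLib

/-!
# Route `ColdStartUniversality` (fixed-cut-off package, Bakry–Émery side, GRADIENT half): the POINTWISE REVERSE LOCAL POINCARÉ INEQUALITY —
# `L∞ → Lipschitz` smoothing of the SZZ semigroup, `Γ^A(κ_t F)(x) ≤ (c/(e^(ct) − 1))·(κ_t(F²)(x) − (κ_tF(x))²)`, uniformly in the volume

Helper file (seat `ym-line-csu-p1`, g29; `--supports stmt-QuantumFields-24809`).  From the integrated reverse local Poincaré inequality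
(`integral_mul_variance_transition_ge_of_hessBound`) by letting the test function concentrate, for the SU(2) lattice Langevin (SZZ) dynamics
at a fixed cut-off:
* ★★★ `wilson_reverseLocalPoincare_of_hessBound` — `K₀ < 2`, `c = 2 − K₀`: for every `C⁵` `f`, `t ≥ 0` and realising kernel family `κ` there
  is a `C³` compactly supported `g` with `κ_t(f∘coords) = g∘coords` and, at EVERY configuration `x`,
  `((e^(ct) − 1)/c)·Γ^A(g)(x) ≤ κ_t((f∘coords)²)(x) − (κ_t(f∘coords)(x))²` (BGL Thm 4.7.2 (iii));
* ★★★ `wilson_reverseLocalPoincare_uniform` — `|β'| < 1/12` ⇒ the same with `c = 2(1 − 12|β'|)`, for EVERY torus size `L`;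
* ★★ `wilson_lipschitz_smoothing_uniform` — `|f∘coords| ≤ M` on the group and `t > 0` ⇒ `Γ^A(g)(x) ≤ (c/(e^(ct) − 1))·M²`: after any
  positive time the semigroup makes every bounded smooth observable uniformly Lipschitz, with a constant independent of `L` and of the
  derivatives of `f` (together with `wilson_carre_transition_le_uniform`: `Γ^A(κ_(t+s)F) ≤ e^(−cs)·(c/(e^(ct)−1))·M²`).
THEOREMS ONLY, no definition, no sorry.  HONEST FRAMING: fixed cut-off; "uniform" = in `L` at fixed `|β'| < 1/12`; the route's scaling
`β'_K → ∞` leaves this window; nothing K-uniform; no crux, rung or summit statement is proved; the Yang–Mills mass gap is NOT proved.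
-/

set_option autoImplicit false

noncomputable section

namespace Summit.QuantumFields.YangMills.Theorems.ColdStartUniversality

open MeasureTheory ProbabilityTheory Matrix Complex Finset Filter Set Metric
open scoped ComplexConjugate BigOperators Matrix NNReal ENNReal Topology
open Literature.Probability.Process Literature.MathematicalPhysics.QuantumFieldTheory
open Literature.MathematicalPhysics.QuantumLattice (fundamentalRep fundamentalLatticeRep continuous_fundamentalRep fundamentalRep_apply)

variable {L : ℕ} [NeZero L]

/-- ★★★ **Pointwise reverse local Poincaré inequality for the SZZ semigroup at a fixed cut-off.**  Under the frame Hessian bound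
`K₀ < 2` (`c = 2 − K₀`): for every `C⁵` `f`, realising Markov kernel family `κ` and `t ≥ 0` there is a `C³` compactly supported `g` with
`κ_t(f∘coords) = g∘coords` and `((e^(ct) − 1)/c)·Γ^A(g)(x) ≤ κ_t((f∘coords)²)(x) − (κ_t(f∘coords)(x))²` at every configuration `x`.
[cite: BakryGentilLedoux2014, Thm 4.7.2 (iii)] -/
theorem wilson_reverseLocalPoincare_of_hessBound (L : ℕ) [NeZero L] (β' K₀ : ℝ) (hK : K₀ < 2)
    (hHess : (∀ (V : (GaugeConfig 3 L (Matrix.specialUnitaryGroup (Fin 2) ℂ))) (Λ : (Edge 3 L × Fin (fundamentalLatticeRep 2).N × Fin (fundamentalLatticeRep 2).N × Bool → ℝ) →L[ℝ] ℝ),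
      ∑ n : Edge 3 L × NoiseIdx (fundamentalLatticeRep 2).N, ∑ m : Edge 3 L × NoiseIdx (fundamentalLatticeRep 2).N,
        Λ ((fun q : Edge 3 L × Fin (fundamentalLatticeRep 2).N × Fin (fundamentalLatticeRep 2).N × Bool => if n.1 = q.1 then (fun z : ℂ => if q.2.2.2 then z.im else z.re) (((Real.sqrt 2 : ℂ) • ((fundamentalLatticeRep 2).lieProj (noiseDir n.2) * (fun (ee : Edge 3 L) => Matrix.of fun (i j : Fin (fundamentalLatticeRep 2).N) => (((fun (V : GaugeConfig 3 L (Matrix.specialUnitaryGroup (Fin 2) ℂ)) (q : Edge 3 L × Fin (fundamentalLatticeRep 2).N × Fin (fundamentalLatticeRep 2).N × Bool) => (fun z : ℂ => if q.2.2.2 then z.im else z.re) ((fundamentalRep (Fin 2) (V q.1) : Matrix (Fin 2) (Fin 2) ℂ) q.2.1 q.2.2.1)) V (ee, i, j, false) : ℝ) : ℂ) + (((fun (V : GaugeConfig 3 L (Matrix.specialUnitaryGroup (Fin 2) ℂ)) (q : Edge 3 L × Fin (fundamentalLatticeRep 2).N × Fin (fundamentalLatticeRep 2).N × Bool) => (fun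 z : ℂ => if q.2.2.2 then z.im else z.re) ((fundamentalRep (Fin 2) (V q.1) : Matrix (Fin 2) (Fin 2) ℂ) q.2.1 q.2.2.1)) V (ee, i, j, true) : ℝ) : ℂ) * Complex.I) q.1)) q.2.1 q.2.2.1) else 0)) * Λ ((fun q : Edge 3 L × Fin (fundamentalLatticeRep 2).N × Fin (fundamentalLatticeRep 2).N × Bool => if m.1 = q.1 then (fun z : ℂ => if q.2.2.2 then z.im else z.re) (((Real.sqrt 2 : ℂ) • ((fundamentalLatticeRep 2).lieProj (noiseDir m.2) * (fun (ee : Edge 3 L) => Matrix.of fun (i j : Fin (fundamentalLatticeRep 2).N) => (((fun (V : GaugeConfig 3 L (Matrix.specialUnitaryGroup (Fin 2) ℂ)) (q : Edge 3 L × Fin (fundamentalLatticeRep 2).N × Fin (fundamentalLatticeRep 2).N × Bool) => (fun z : ℂ => if q.2.2.2 then z.im else z.re) ((fundamentalRep (Fin 2) (V q.1) : Matrix (Fin 2) (Fin 2) ℂ) q.2.1 q.2.2.1)) V (ee, i, j, false) : ℝ) : ℂ) + (((fun (V : GaugeConfig 3 L (Matrix.specialUnitaryGroup (Fin 2) ℂ))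 (q : Edge 3 L × Fin (fundamentalLatticeRep 2).N × Fin (fundamentalLatticeRep 2).N × Bool) => (fun z : ℂ => if q.2.2.2 then z.im else z.re) ((fundamentalRep (Fin 2) (V q.1) : Matrix (Fin 2) (Fin 2) ℂ) q.2.1 q.2.2.1)) V (ee, i, j, true) : ℝ) : ℂ) * Complex.I) q.1)) q.2.1 q.2.2.1) else 0)) *
          fderiv ℝ (fun z : (Edge 3 L × Fin (fundamentalLatticeRep 2).N × Fin (fundamentalLatticeRep 2).N × Bool → ℝ) => fderiv ℝ (fun y : (Edge 3 L × Fin (fundamentalLatticeRep 2).N × Fin (fundamentalLatticeRep 2).N × Bool → ℝ) => β' * ∑ p : Plaquette 3 L, (rootedLoop (fun (ee : Edge 3 L) (i j : Fin (fundamentalLatticeRep 2).N) => ((y (ee, i, j, false) : ℝ) : ℂ) + ((y (ee, i, j, true) : ℝ) : ℂ) * Complex.I) (p.1, p.2.1.1) p.2.1.2 false).trace.re) z (fun q : Edge 3 L × Fin (fundamentalLatticeRep 2).N × Fin (fundamentalLatticeRep 2).N × Bool => if m.1 = q.1 then (fun z : ℂ => if q.2.2.2 then z.im else z.re) (((Real.sqrt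 2 : ℂ) • ((fundamentalLatticeRep 2).lieProj (noiseDir m.2) * (fun (ee : Edge 3 L) => Matrix.of fun (i j : Fin (fundamentalLatticeRep 2).N) => ((z (ee, i, j, false) : ℝ) : ℂ) + ((z (ee, i, j, true) : ℝ) : ℂ) * Complex.I) q.1)) q.2.1 q.2.2.1) else 0)) ((fun (V : GaugeConfig 3 L (Matrix.specialUnitaryGroup (Fin 2) ℂ)) (q : Edge 3 L × Fin (fundamentalLatticeRep 2).N × Fin (fundamentalLatticeRep 2).N × Bool) => (fun z : ℂ => if q.2.2.2 then z.im else z.re) ((fundamentalRep (Fin 2) (V q.1) : Matrix (Fin 2) (Fin 2) ℂ) q.2.1 q.2.2.1)) V) (fun q : Edge 3 L × Fin (fundamentalLatticeRep 2).N × Fin (fundamentalLatticeRep 2).N × Bool => if n.1 = q.1 then (fun z : ℂ => if q.2.2.2 then z.im else z.re) (((Real.sqrt 2 : ℂ) • ((fundamentalLatticeRep 2).lieProj (noiseDir n.2) * (fun (ee : Edge 3 L) => Matrix.of fun (i j : Fin (fundamentalLatticeRep 2).N) => (((fun (V : GaugeConfig 3 L (Matrix.specialUnitaryGroup (Fin 2)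 ℂ)) (q : Edge 3 L × Fin (fundamentalLatticeRep 2).N × Fin (fundamentalLatticeRep 2).N × Bool) => (fun z : ℂ => if q.2.2.2 then z.im else z.re) ((fundamentalRep (Fin 2) (V q.1) : Matrix (Fin 2) (Fin 2) ℂ) q.2.1 q.2.2.1)) V (ee, i, j, false) : ℝ) : ℂ) + (((fun (V : GaugeConfig 3 L (Matrix.specialUnitaryGroup (Fin 2) ℂ)) (q : Edge 3 L × Fin (fundamentalLatticeRep 2).N × Fin (fundamentalLatticeRep 2).N × Bool) => (fun z : ℂ => if q.2.2.2 then z.im else z.re) ((fundamentalRep (Fin 2) (V q.1) : Matrix (Fin 2) (Fin 2) ℂ) q.2.1 q.2.2.1)) V (ee, i, j, true) : ℝ) : ℂ) * Complex.I) q.1)) q.2.1 q.2.2.1) else 0)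
        ≤ K₀ * ∑ n : Edge 3 L × NoiseIdx (fundamentalLatticeRep 2).N, (Λ (fun q : Edge 3 L × Fin (fundamentalLatticeRep 2).N × Fin (fundamentalLatticeRep 2).N × Bool => if n.1 = q.1 then (fun z : ℂ => if q.2.2.2 then z.im else z.re) (((Real.sqrt 2 : ℂ) • ((fundamentalLatticeRep 2).lieProj (noiseDir n.2) * (fun (ee : Edge 3 L) => Matrix.of fun (i j : Fin (fundamentalLatticeRep 2).N) => (((fun (V : GaugeConfig 3 L (Matrix.specialUnitaryGroup (Fin 2) ℂ)) (q : Edge 3 L × Fin (fundamentalLatticeRep 2).N × Fin (fundamentalLatticeRep 2).N × Bool) => (fun z : ℂ => if q.2.2.2 then z.im else z.re) ((fundamentalRep (Fin 2) (V q.1) : Matrix (Fin 2) (Fin 2) ℂ) q.2.1 q.2.2.1)) V (ee, i, j, false) : ℝ) : ℂ) + (((fun (V : GaugeConfig 3 L (Matrix.specialUnitaryGroup (Fin 2) ℂ)) (q : Edge 3 L × Fin (fundamentalLatticeRep 2).N × Fin (fundamentalLatticeRep 2).N × Bool) => (fun z : ℂ => if q.2.2.2 then z.im else z.re) ((fundamentalRep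 (Fin 2) (V q.1) : Matrix (Fin 2) (Fin 2) ℂ) q.2.1 q.2.2.1)) V (ee, i, j, true) : ℝ) : ℂ) * Complex.I) q.1)) q.2.1 q.2.2.1) else 0)) ^ 2))
    (κ : ℝ≥0 → Kernel (GaugeConfig 3 L (Matrix.specialUnitaryGroup (Fin 2) ℂ))
      (GaugeConfig 3 L (Matrix.specialUnitaryGroup (Fin 2) ℂ))) [∀ t, IsMarkovKernel (κ t)]
    (hreal : ∀ (t : ℝ≥0) (x : GaugeConfig 3 L (Matrix.specialUnitaryGroup (Fin 2) ℂ))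
        (Ω : Type) [MeasurableSpace Ω] (P : Measure Ω) [IsProbabilityMeasure P]
        (W : ℝ≥0 → Ω → (Edge 3 L × NoiseIdx 2 → ℝ)) (hW : IsFlatBrownian W P)
        (U : ℝ≥0 → Ω → GaugeConfig 3 L (Matrix.specialUnitaryGroup (Fin 2) ℂ)),
        (∀ ω, U 0 ω = x) →
        (latticeLangevinDynamics (fundamentalLatticeRep 2) β').IsSolution (fundamentalRep (Fin 2))
          hW.natFiltration P W U →
        κ t x = P.map (U t))
    {f : (Edge 3 L × Fin 2 × Fin 2 × Bool → ℝ) → ℝ} (hf : ContDiff ℝ 5 f) (t : ℝ≥0) :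
    let coords : GaugeConfig 3 L (Matrix.specialUnitaryGroup (Fin 2) ℂ) → (Edge 3 L × Fin 2 × Fin 2 × Bool → ℝ) :=
      fun V q => (fun z : ℂ => if q.2.2.2 then z.im else z.re)
        ((fundamentalRep (Fin 2) (V q.1) : Matrix (Fin 2) (Fin 2) ℂ) q.2.1 q.2.2.1)
    let A : GaugeConfig 3 L (Matrix.specialUnitaryGroup (Fin 2) ℂ) → (Edge 3 L × Fin 2 × Fin 2 × Bool) →
        (Edge 3 L × Fin 2 × Fin 2 × Bool) → ℝ := fun V i j =>
      ∑ n : Edge 3 L × NoiseIdx 2,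
        (if n.1 = i.1 then (fun z : ℂ => if i.2.2.2 then z.im else z.re)
          ((latticeLangevinDynamics (fundamentalLatticeRep 2) β').noise
            (matrixConfig (fundamentalRep (Fin 2)) V) i.1 n.2 i.2.1 i.2.2.1) else 0) *
        (if n.1 = j.1 then (fun z : ℂ => if j.2.2.2 then z.im else z.re)
          ((latticeLangevinDynamics (fundamentalLatticeRep 2) β').noise
            (matrixConfig (fundamentalRep (Fin 2)) V) j.1 n.2 j.2.1 j.2.2.1) else 0)
    ∃ g : (Edge 3 L × Fin 2 × Fin 2 × Bool → ℝ) → ℝ, ContDiff ℝ 3 g ∧ HasCompactSupport g ∧ (∀ x, ∫ y, f (coords y) ∂(κ t x) = g (coords x)) ∧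
      ∀ x₀, (Real.exp ((2 - K₀) * (t : ℝ)) - 1) / (2 - K₀) * (∑ i : Edge 3 L × Fin 2 × Fin 2 × Bool, ∑ j : Edge 3 L × Fin 2 × Fin 2 × Bool, fderiv ℝ g (coords x₀) (Pi.single i 1) * fderiv ℝ g (coords x₀) (Pi.single j 1) * A x₀ i j) ≤
        ∫ y, f (coords y) * f (coords y) ∂(κ t x₀) - (∫ y, f (coords y) ∂(κ t x₀)) ^ 2 := by
  intro coords A
  classical
  haveI := secondCountableTopology_su2
  haveI := borelSpace_config L
  set μ : Measure (GaugeConfig 3 L (Matrix.specialUnitaryGroup (Fin 2) ℂ)) := (wilsonMeasure (d := 3) (L := L) (fundamentalRep (Fin 2)) β') with hμ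
  haveI : IsProbabilityMeasure μ :=
    isProbabilityMeasure_wilsonMeasure (d := 3) (L := L) (fundamentalRep (Fin 2)) (continuous_fundamentalRep (Fin 2)) β'
  have hco : Continuous coords := continuous_coords (L := L)
  have hInt : ∀ {Φ : (GaugeConfig 3 L (Matrix.specialUnitaryGroup (Fin 2) ℂ)) → ℝ}, Continuous Φ → Integrable Φ μ := fun hΦ => integrable_of_continuous_of_compactSpace hΦ μ
  set q : ℝ := (Real.exp ((2 - K₀) * (t : ℝ)) - 1) / (2 - K₀) with hq
  -- §1 cut-off of `f`
  obtain ⟨f₁, hf₁, hf₁c, hf₁eq⟩ := exists_contDiff_hasCompactSupport_eqOn (n := 5) hf 1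
  have hnear : ∀ x : (GaugeConfig 3 L (Matrix.specialUnitaryGroup (Fin 2) ℂ)), f₁ =ᶠ[𝓝 (coords x)] f := fun x => hf₁eq _ (norm_coords_le_one x)
  have hval : ∀ x : (GaugeConfig 3 L (Matrix.specialUnitaryGroup (Fin 2) ℂ)), f₁ (coords x) = f (coords x) := fun x => (hnear x).self_of_nhds
  have hfd : ∀ x : (GaugeConfig 3 L (Matrix.specialUnitaryGroup (Fin 2) ℂ)), fderiv ℝ f₁ (coords x) = fderiv ℝ f (coords x) := fun x => (hnear x).fderiv_eq
  have hΓeq : ∀ x : (GaugeConfig 3 L (Matrix.specialUnitaryGroup (Fin 2) ℂ)), (∑ i : Edge 3 L × Fin 2 × Fin 2 × Bool, ∑ j : Edge 3 L × Fin 2 × Fin 2 × Bool, fderiv ℝ f₁ (coords x) (Pi.single i 1) * fderiv ℝ f₁ (coords x) (Pi.single j 1) * A x i j) = (∑ i : Edge 3 L × Fin 2 × Fin 2 × Bool, ∑ j : Edge 3 L × Fin 2 × Fin 2 × Bool, fderiv ℝ f (coords x) (Pi.single i 1) * fderiv ℝ f (coords x) (Pi.single j 1) * A x i j) := fun x =>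 by rw [hfd x]
  have hf₁3 : ContDiff ℝ 3 f₁ := hf₁.of_le (by norm_num)
  obtain ⟨g, hg, hgc, hgrep⟩ := transitionKernel_preserves_dynkinClass L β' κ hreal t hf₁3
  have hP1 : ∀ x : (GaugeConfig 3 L (Matrix.specialUnitaryGroup (Fin 2) ℂ)), ∫ y, f₁ (coords y) ∂(κ t x) = g (coords x) := fun x => hgrep x
  have hgrep' : ∀ x : (GaugeConfig 3 L (Matrix.specialUnitaryGroup (Fin 2) ℂ)), ∫ y, f (coords y) ∂(κ t x) = g (coords x) := fun x =>
    (integral_congr_ae (ae_of_all _ fun y => (hval y).symm)).trans (hP1 x)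
  refine ⟨g, hg, hgc, hgrep', fun x₀ => ?_⟩
  -- §2 the integrated inequality for every admissible test function
  have hflow : ∀ (h : (Edge 3 L × Fin 2 × Fin 2 × Bool → ℝ) → ℝ), ContDiff ℝ 5 h → HasCompactSupport h → (∀ x : (GaugeConfig 3 L (Matrix.specialUnitaryGroup (Fin 2) ℂ)), 0 ≤ h (coords x)) →
      q * ∫ x, h (coords x) * (∑ i : Edge 3 L × Fin 2 × Fin 2 × Bool, ∑ j : Edge 3 L × Fin 2 × Fin 2 × Bool, fderiv ℝ g (coords x) (Pi.single i 1) * fderiv ℝ g (coords x) (Pi.single j 1) * A x i j) ∂μ ≤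
      ∫ x, h (coords x) * (∫ y, f₁ (coords y) * f₁ (coords y) ∂(κ t x)) ∂μ - ∫ x, h (coords x) * (∫ y, f₁ (coords y) ∂(κ t x)) ^ 2 ∂μ :=
    fun h hh hhc hh0 => integral_mul_variance_transition_ge_of_hessBound L β' K₀ hK hHess κ hreal hf₁ hf₁c hh hhc t hg hgc hh0 hP1
  -- §3 the three kernel quantities as continuous functions of the coordinates
  obtain ⟨s, c, hs, -, -, -, -⟩ := exists_noiseFrame L
  set s2 : (Edge 3 L × NoiseIdx (fundamentalLatticeRep 2).N) → ((Edge 3 L × Fin 2 × Fin 2 × Bool → ℝ) →L[ℝ] (Edge 3 L × Fin 2 × Fin 2 × Bool → ℝ)) := s with hs2def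
  have hs2 : ∀ (n : Edge 3 L × NoiseIdx (fundamentalLatticeRep 2).N) (y : (Edge 3 L × Fin 2 × Fin 2 × Bool → ℝ)), s2 n y = (fun q : Edge 3 L × Fin (fundamentalLatticeRep 2).N × Fin (fundamentalLatticeRep 2).N × Bool => if n.1 = q.1 then (fun z : ℂ => if q.2.2.2 then z.im else z.re) (((Real.sqrt 2 : ℂ) • ((fundamentalLatticeRep 2).lieProj (noiseDir n.2) * (fun (ee : Edge 3 L) => Matrix.of fun (i j : Fin (fundamentalLatticeRep 2).N) => ((y (ee, i, j, false) : ℝ) : ℂ) + ((y (ee, i, j, true) : ℝ) : ℂ) * Complex.I) q.1)) q.2.1 q.2.2.1) else 0) := fun n y => hs n y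
  have hGam : ∀ {φ : (Edge 3 L × Fin 2 × Fin 2 × Bool → ℝ) → ℝ} (x : (GaugeConfig 3 L (Matrix.specialUnitaryGroup (Fin 2) ℂ))), (∑ i : Edge 3 L × Fin 2 × Fin 2 × Bool, ∑ j : Edge 3 L × Fin 2 × Fin 2 × Bool, fderiv ℝ φ (coords x) (Pi.single i 1) * fderiv ℝ φ (coords x) (Pi.single j 1) * A x i j) = ∑ n, (fderiv ℝ φ (coords x) (s2 n (coords x))) ^ 2 := by
    intro φ x
    have h : (∑ i : Edge 3 L × Fin 2 × Fin 2 × Bool, ∑ j : Edge 3 L × Fin 2 × Fin 2 × Bool, fderiv ℝ φ (coords x) (Pi.single i 1) * fderiv ℝ φ (coords x) (Pi.single j 1) * A x i j) =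
        ∑ n : Edge 3 L × NoiseIdx (fundamentalLatticeRep 2).N, fderiv ℝ φ (coords x) (fun q : Edge 3 L × Fin (fundamentalLatticeRep 2).N × Fin (fundamentalLatticeRep 2).N × Bool => if n.1 = q.1 then (fun z : ℂ => if q.2.2.2 then z.im else z.re) (((Real.sqrt 2 : ℂ) • ((fundamentalLatticeRep 2).lieProj (noiseDir n.2) * (fun (ee : Edge 3 L) => Matrix.of fun (i j : Fin (fundamentalLatticeRep 2).N) => ((coords x (ee, i, j, false) : ℝ) : ℂ) + ((coords x (ee, i, j, true) : ℝ) : ℂ) * Complex.I) q.1)) q.2.1 q.2.2.1) else 0) * fderiv ℝ φ (coords x) (fun q : Edge 3 L × Fin (fundamentalLatticeRep 2).N × Fin (fundamentalLatticeRep 2).N × Bool => if n.1 = q.1 then (fun z : ℂ => if q.2.2.2 then z.im else z.re) (((Real.sqrt 2 : ℂ) • ((fundamentalLatticeRep 2).lieProj (noiseDir n.2) * (fun (ee : Edge 3 L) => Matrix.of fun (i j : Fin (fundamentalLatticeRep 2).N) => ((coords x (ee, i, j, false) : ℝ) : ℂ) + ((coords x (ee, i, j, true) : ℝ) : ℂ)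 * Complex.I) q.1)) q.2.1 q.2.2.1) else 0) :=
      carre_eq_sum_frameDeriv_mul L β' φ φ x
    rw [h]
    refine Finset.sum_congr rfl fun n _ => ?_
    rw [← hs2 n (coords x), sq]
  set Gg : (Edge 3 L × Fin 2 × Fin 2 × Bool → ℝ) → ℝ := fun y => ∑ n, (fderiv ℝ g y (s2 n y)) ^ 2 with hGg
  have hGgC : Continuous Gg := continuous_finsetSum _ fun n _ => ((contDiff_frameDeriv (k := 2) hg (s2 n)).continuous).pow 2
  obtain ⟨g2, hg2, -, hg2rep⟩ := transitionKernel_preserves_dynkinClass L β' κ hreal t (hf₁3.mul hf₁3)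
  have hP2 : ∀ x : (GaugeConfig 3 L (Matrix.specialUnitaryGroup (Fin 2) ℂ)), ∫ y, f₁ (coords y) * f₁ (coords y) ∂(κ t x) = g2 (coords x) := fun x => hg2rep x
  set Φ : (Edge 3 L × Fin 2 × Fin 2 × Bool → ℝ) → ℝ := fun y => q * Gg y - g2 y + g y ^ 2 with hΦ
  have hΦc : Continuous Φ := ((continuous_const.mul hGgC).sub hg2.continuous).add (hg.continuous.pow 2)
  have hΦx : ∀ x : (GaugeConfig 3 L (Matrix.specialUnitaryGroup (Fin 2) ℂ)), Φ (coords x) = q * (∑ i : Edge 3 L × Fin 2 × Fin 2 × Bool, ∑ j : Edge 3 L × Fin 2 × Fin 2 × Bool, fderiv ℝ g (coords x) (Pi.single i 1) * fderiv ℝ g (coords x) (Pi.single j 1) * A x i j) - ∫ y, f₁ (coords y) * f₁ (coords y) ∂(κ t x) + (∫ y, f₁ (coords y) ∂(κ t x)) ^ 2 := by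
    intro x; rw [hP2 x, hP1 x, hGam x]
  -- §4 suppose the bound fails at `x₀`
  by_contra hlt
  rw [not_le] at hlt
  have hΦ0 : 0 < Φ (coords x₀) := by
    rw [hΦx x₀]
    have e1 : ∫ y, f₁ (coords y) * f₁ (coords y) ∂(κ t x₀) = ∫ y, f (coords y) * f (coords y) ∂(κ t x₀) :=
      integral_congr_ae (ae_of_all _ fun y => by simp only [hval y])
    have e2 : ∫ y, f₁ (coords y) ∂(κ t x₀) = ∫ y, f (coords y) ∂(κ t x₀) := integral_congr_ae (ae_of_all _ fun y => hval y)
    rw [e1, e2]; linarith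
  have hO : IsOpen {y : (Edge 3 L × Fin 2 × Fin 2 × Bool → ℝ) | 0 < Φ y} := isOpen_lt continuous_const hΦc
  obtain ⟨ε, hε, hball⟩ := Metric.isOpen_iff.1 hO (coords x₀) hΦ0
  let χ : ContDiffBump (coords x₀) := ⟨ε / 4, ε / 2, by positivity, by linarith⟩
  have hχ5 : ContDiff ℝ 5 (χ : (Edge 3 L × Fin 2 × Fin 2 × Bool → ℝ) → ℝ) := χ.contDiff
  have hχ0 : ∀ x : (GaugeConfig 3 L (Matrix.specialUnitaryGroup (Fin 2) ℂ)), 0 ≤ (χ : (Edge 3 L × Fin 2 × Fin 2 × Bool → ℝ) → ℝ) (coords x) := fun x => χ.nonneg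
  have hprod0 : ∀ x : (GaugeConfig 3 L (Matrix.specialUnitaryGroup (Fin 2) ℂ)), 0 ≤ (χ : (Edge 3 L × Fin 2 × Fin 2 × Bool → ℝ) → ℝ) (coords x) * Φ (coords x) := by
    intro x
    by_cases hz : (χ : (Edge 3 L × Fin 2 × Fin 2 × Bool → ℝ) → ℝ) (coords x) = 0
    · rw [hz, zero_mul]
    · have hmem : coords x ∈ Function.support (χ : (Edge 3 L × Fin 2 × Fin 2 × Bool → ℝ) → ℝ) := hz
      rw [χ.support_eq] at hmem
      have hin : coords x ∈ ball (coords x₀) ε := ball_subset_ball (by show χ.rOut ≤ ε; simp only [χ]; linarith) hmem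
      exact mul_nonneg χ.nonneg (le_of_lt (hball hin))
  have hpos0 : 0 < (χ : (Edge 3 L × Fin 2 × Fin 2 × Bool → ℝ) → ℝ) (coords x₀) * Φ (coords x₀) := by
    rw [χ.one_of_mem_closedBall (mem_closedBall_self (by show (0 : ℝ) ≤ χ.rIn; simp only [χ]; positivity)), one_mul]
    exact hΦ0
  have cP : Continuous fun x : (GaugeConfig 3 L (Matrix.specialUnitaryGroup (Fin 2) ℂ)) => (χ : (Edge 3 L × Fin 2 × Fin 2 × Bool → ℝ) → ℝ) (coords x) * Φ (coords x) :=
    (χ.continuous.comp hco).mul (hΦc.comp hco)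
  set π : Measure (GaugeConfig 3 L (Matrix.specialUnitaryGroup (Fin 2) ℂ)) := Measure.pi fun _ : Edge 3 L => haarProbability (Matrix.specialUnitaryGroup (Fin 2) ℂ) with hπ
  haveI : π.IsOpenPosMeasure := by
    rw [hπ]
    haveI : ∀ _e : Edge 3 L, (haarProbability (Matrix.specialUnitaryGroup (Fin 2) ℂ)).IsOpenPosMeasure := fun _ => by
      unfold haarProbability; infer_instance
    infer_instance
  have hπμ : π ≪ μ := by
    rw [hμ, Literature.MathematicalPhysics.QuantumLattice.wilsonMeasure_eq_tilted_pi (fundamentalRep (Fin 2))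
      (continuous_fundamentalRep (n := Fin 2)) β', ← hπ]
    refine absolutelyContinuous_tilted ?_
    obtain ⟨B, hB⟩ := exists_abs_wilsonAction_le (d := 3) (L := L) (fundamentalRep (Fin 2)) (continuous_fundamentalRep (Fin 2))
    refine Integrable.of_bound (((measurable_wilsonAction (d := 3) (L := L) (fundamentalRep (Fin 2)) (continuous_fundamentalRep (Fin 2))).const_mul _).exp).aestronglyMeasurable
      (Real.exp (|β'| * B)) (ae_of_all _ fun U => ?_)
    rw [Real.norm_eq_abs, Real.abs_exp, Real.exp_le_exp]
    have h1 : |β' * wilsonAction (fundamentalRep (Fin 2)) U| ≤ |β'| * B := by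
      rw [abs_mul]; exact mul_le_mul_of_nonneg_left (hB U) (abs_nonneg _)
    have h2 := (abs_le.1 h1).1
    linarith
  have hIpos : 0 < ∫ x, (χ : (Edge 3 L × Fin 2 × Fin 2 × Bool → ℝ) → ℝ) (coords x) * Φ (coords x) ∂μ := by
    rw [integral_pos_iff_support_of_nonneg (fun x => hprod0 x) (hInt cP)]
    have hU : IsOpen {x : (GaugeConfig 3 L (Matrix.specialUnitaryGroup (Fin 2) ℂ)) | 0 < (χ : (Edge 3 L × Fin 2 × Fin 2 × Bool → ℝ) → ℝ) (coords x) * Φ (coords x)} := isOpen_lt continuous_const cP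
    have hUπ : 0 < π {x : (GaugeConfig 3 L (Matrix.specialUnitaryGroup (Fin 2) ℂ)) | 0 < (χ : (Edge 3 L × Fin 2 × Fin 2 × Bool → ℝ) → ℝ) (coords x) * Φ (coords x)} := hU.measure_pos π ⟨x₀, hpos0⟩
    have hUμ : 0 < μ {x : (GaugeConfig 3 L (Matrix.specialUnitaryGroup (Fin 2) ℂ)) | 0 < (χ : (Edge 3 L × Fin 2 × Fin 2 × Bool → ℝ) → ℝ) (coords x) * Φ (coords x)} :=
      pos_iff_ne_zero.2 fun h0 => hUπ.ne' (hπμ h0)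
    exact hUμ.trans_le (measure_mono fun x hx => ne_of_gt hx)
  have hle : ∫ x, (χ : (Edge 3 L × Fin 2 × Fin 2 × Bool → ℝ) → ℝ) (coords x) * Φ (coords x) ∂μ ≤ 0 := by
    have h1 := hflow χ hχ5 χ.hasCompactSupport hχ0
    have cχ : Continuous fun x : (GaugeConfig 3 L (Matrix.specialUnitaryGroup (Fin 2) ℂ)) => (χ : (Edge 3 L × Fin 2 × Fin 2 × Bool → ℝ) → ℝ) (coords x) := χ.continuous.comp hco
    have c2 : Continuous fun x : (GaugeConfig 3 L (Matrix.specialUnitaryGroup (Fin 2) ℂ)) => ∫ y, f₁ (coords y) * f₁ (coords y) ∂(κ t x) := by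
      rw [show (fun x : (GaugeConfig 3 L (Matrix.specialUnitaryGroup (Fin 2) ℂ)) => ∫ y, f₁ (coords y) * f₁ (coords y) ∂(κ t x)) = fun x => g2 (coords x) from funext fun x => hP2 x]
      exact hg2.continuous.comp hco
    have c1 : Continuous fun x : (GaugeConfig 3 L (Matrix.specialUnitaryGroup (Fin 2) ℂ)) => (∫ y, f₁ (coords y) ∂(κ t x)) ^ 2 := by
      rw [show (fun x : (GaugeConfig 3 L (Matrix.specialUnitaryGroup (Fin 2) ℂ)) => (∫ y, f₁ (coords y) ∂(κ t x)) ^ 2) = fun x => g (coords x) ^ 2 from funext fun x => by rw [hP1 x]]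
      exact (hg.continuous.comp hco).pow 2
    have cG : Continuous fun x : (GaugeConfig 3 L (Matrix.specialUnitaryGroup (Fin 2) ℂ)) => (∑ i : Edge 3 L × Fin 2 × Fin 2 × Bool, ∑ j : Edge 3 L × Fin 2 × Fin 2 × Bool, fderiv ℝ g (coords x) (Pi.single i 1) * fderiv ℝ g (coords x) (Pi.single j 1) * A x i j) := by
      rw [show (fun x : (GaugeConfig 3 L (Matrix.specialUnitaryGroup (Fin 2) ℂ)) => (∑ i : Edge 3 L × Fin 2 × Fin 2 × Bool, ∑ j : Edge 3 L × Fin 2 × Fin 2 × Bool, fderiv ℝ g (coords x) (Pi.single i 1) * fderiv ℝ g (coords x) (Pi.single j 1) * A x i j)) = fun x => Gg (coords x) from funext fun x => hGam x]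
      exact hGgC.comp hco
    have i2 : Integrable (fun x => (χ : (Edge 3 L × Fin 2 × Fin 2 × Bool → ℝ) → ℝ) (coords x) * (∫ y, f₁ (coords y) * f₁ (coords y) ∂(κ t x))) μ := hInt (cχ.mul c2)
    have i1 : Integrable (fun x => (χ : (Edge 3 L × Fin 2 × Fin 2 × Bool → ℝ) → ℝ) (coords x) * (∫ y, f₁ (coords y) ∂(κ t x)) ^ 2) μ := hInt (cχ.mul c1)
    have i3 : Integrable (fun x => q * ((χ : (Edge 3 L × Fin 2 × Fin 2 × Bool → ℝ) → ℝ) (coords x) * (∑ i : Edge 3 L × Fin 2 × Fin 2 × Bool, ∑ j : Edge 3 L × Fin 2 × Fin 2 × Bool, fderiv ℝ g (coords x) (Pi.single i 1) * fderiv ℝ g (coords x) (Pi.single j 1) * A x i j))) μ := (hInt (cχ.mul cG)).const_mul q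
    have i32 : Integrable (fun x => q * ((χ : (Edge 3 L × Fin 2 × Fin 2 × Bool → ℝ) → ℝ) (coords x) * (∑ i : Edge 3 L × Fin 2 × Fin 2 × Bool, ∑ j : Edge 3 L × Fin 2 × Fin 2 × Bool, fderiv ℝ g (coords x) (Pi.single i 1) * fderiv ℝ g (coords x) (Pi.single j 1) * A x i j)) -
        (χ : (Edge 3 L × Fin 2 × Fin 2 × Bool → ℝ) → ℝ) (coords x) * (∫ y, f₁ (coords y) * f₁ (coords y) ∂(κ t x))) μ := i3.sub i2
    have e : ∫ x, (χ : (Edge 3 L × Fin 2 × Fin 2 × Bool → ℝ) → ℝ) (coords x) * Φ (coords x) ∂μ =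
        q * ∫ x, (χ : (Edge 3 L × Fin 2 × Fin 2 × Bool → ℝ) → ℝ) (coords x) * (∑ i : Edge 3 L × Fin 2 × Fin 2 × Bool, ∑ j : Edge 3 L × Fin 2 × Fin 2 × Bool, fderiv ℝ g (coords x) (Pi.single i 1) * fderiv ℝ g (coords x) (Pi.single j 1) * A x i j) ∂μ -
          ∫ x, (χ : (Edge 3 L × Fin 2 × Fin 2 × Bool → ℝ) → ℝ) (coords x) * (∫ y, f₁ (coords y) * f₁ (coords y) ∂(κ t x)) ∂μ +
          ∫ x, (χ : (Edge 3 L × Fin 2 × Fin 2 × Bool → ℝ) → ℝ) (coords x) * (∫ y, f₁ (coords y) ∂(κ t x)) ^ 2 ∂μ := by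
      rw [← integral_const_mul, ← integral_sub i3 i2, ← integral_add i32 i1]
      refine integral_congr_ae (ae_of_all _ fun x => ?_)
      show (χ : (Edge 3 L × Fin 2 × Fin 2 × Bool → ℝ) → ℝ) (coords x) * Φ (coords x) = _
      rw [hΦx x]; ring
    rw [e]; linarith
  exact absurd hle (not_le.2 hIpos)

/-- ★★★ **Volume-uniform reverse local Poincaré inequality for the SZZ semigroup at `|β'| < 1/12`** (`c = 2(1 − 12|β'|)`): for EVERY `L`,
realising kernel family `κ`, `C⁵` `f` and `t ≥ 0` there is a `C³` compactly supported `g` with `κ_t(f∘coords) = g∘coords` and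
`((e^(ct) − 1)/c)·Γ^A(g)(x) ≤ κ_t((f∘coords)²)(x) − (κ_t(f∘coords)(x))²` for all `x`. [cite: BakryGentilLedoux2014, Thm 4.7.2 (iii); ShenZhuZhu2022 §4 Thm 4.2] -/
theorem wilson_reverseLocalPoincare_uniform (L : ℕ) [NeZero L] (β' : ℝ)
    (κ : ℝ≥0 → Kernel (GaugeConfig 3 L (Matrix.specialUnitaryGroup (Fin 2) ℂ))
      (GaugeConfig 3 L (Matrix.specialUnitaryGroup (Fin 2) ℂ))) [∀ t, IsMarkovKernel (κ t)]
    (hreal : ∀ (t : ℝ≥0) (x : GaugeConfig 3 L (Matrix.specialUnitaryGroup (Fin 2) ℂ))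
        (Ω : Type) [MeasurableSpace Ω] (P : Measure Ω) [IsProbabilityMeasure P]
        (W : ℝ≥0 → Ω → (Edge 3 L × NoiseIdx 2 → ℝ)) (hW : IsFlatBrownian W P)
        (U : ℝ≥0 → Ω → GaugeConfig 3 L (Matrix.specialUnitaryGroup (Fin 2) ℂ)),
        (∀ ω, U 0 ω = x) →
        (latticeLangevinDynamics (fundamentalLatticeRep 2) β').IsSolution (fundamentalRep (Fin 2))
          hW.natFiltration P W U →
        κ t x = P.map (U t))
    (t : ℝ≥0) {f : (Edge 3 L × Fin 2 × Fin 2 × Bool → ℝ) → ℝ} (hf : ContDiff ℝ 5 f) (hβ : |β'| < 1 / 12) :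
    let coords : GaugeConfig 3 L (Matrix.specialUnitaryGroup (Fin 2) ℂ) → (Edge 3 L × Fin 2 × Fin 2 × Bool → ℝ) :=
      fun V q => (fun z : ℂ => if q.2.2.2 then z.im else z.re)
        ((fundamentalRep (Fin 2) (V q.1) : Matrix (Fin 2) (Fin 2) ℂ) q.2.1 q.2.2.1)
    let A : GaugeConfig 3 L (Matrix.specialUnitaryGroup (Fin 2) ℂ) → (Edge 3 L × Fin 2 × Fin 2 × Bool) →
        (Edge 3 L × Fin 2 × Fin 2 × Bool) → ℝ := fun V i j =>
      ∑ n : Edge 3 L × NoiseIdx 2,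
        (if n.1 = i.1 then (fun z : ℂ => if i.2.2.2 then z.im else z.re)
          ((latticeLangevinDynamics (fundamentalLatticeRep 2) β').noise
            (matrixConfig (fundamentalRep (Fin 2)) V) i.1 n.2 i.2.1 i.2.2.1) else 0) *
        (if n.1 = j.1 then (fun z : ℂ => if j.2.2.2 then z.im else z.re)
          ((latticeLangevinDynamics (fundamentalLatticeRep 2) β').noise
            (matrixConfig (fundamentalRep (Fin 2)) V) j.1 n.2 j.2.1 j.2.2.1) else 0)
    ∃ g : (Edge 3 L × Fin 2 × Fin 2 × Bool → ℝ) → ℝ, ContDiff ℝ 3 g ∧ HasCompactSupport g ∧ (∀ x, ∫ y, f (coords y) ∂(κ t x) = g (coords x)) ∧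
      ∀ x₀, (Real.exp (2 * (1 - 12 * |β'|) * (t : ℝ)) - 1) / (2 * (1 - 12 * |β'|)) * (∑ i : Edge 3 L × Fin 2 × Fin 2 × Bool, ∑ j : Edge 3 L × Fin 2 × Fin 2 × Bool, fderiv ℝ g (coords x₀) (Pi.single i 1) * fderiv ℝ g (coords x₀) (Pi.single j 1) * A x₀ i j) ≤
        ∫ y, f (coords y) * f (coords y) ∂(κ t x₀) - (∫ y, f (coords y) ∂(κ t x₀)) ^ 2 := by
  intro coords A
  have h := wilson_reverseLocalPoincare_of_hessBound L β' (24 * |β'|) (by linarith) (wilson_hessBound L β') κ hreal hf t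
  have e : (2 - 24 * |β'| : ℝ) = 2 * (1 - 12 * |β'|) := by ring
  rw [e] at h
  exact h

/-- ★★ **`L∞ → Lipschitz` smoothing by the SZZ semigroup, uniform in the volume.**  At `|β'| < 1/12` (`c = 2(1 − 12|β'|)`), for every `L`,
`κ`, `C⁵` `f` with `|f∘coords| ≤ M` on the group and `t > 0`: the representative `g` of `κ_t(f∘coords)` satisfies
`Γ^A(g)(x) ≤ (c/(e^(ct) − 1))·M²` at every `x` — a Lipschitz bound after time `t` that does not see the derivatives of `f`.
[cite: BakryGentilLedoux2014, Thm 4.7.2 (iii) / (4.7.6)] -/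
theorem wilson_lipschitz_smoothing_uniform (L : ℕ) [NeZero L] (β' : ℝ) (hβ : |β'| < 1 / 12)
    (κ : ℝ≥0 → Kernel (GaugeConfig 3 L (Matrix.specialUnitaryGroup (Fin 2) ℂ))
      (GaugeConfig 3 L (Matrix.specialUnitaryGroup (Fin 2) ℂ))) [∀ t, IsMarkovKernel (κ t)]
    (hreal : ∀ (t : ℝ≥0) (x : GaugeConfig 3 L (Matrix.specialUnitaryGroup (Fin 2) ℂ))
        (Ω : Type) [MeasurableSpace Ω] (P : Measure Ω) [IsProbabilityMeasure P]
        (W : ℝ≥0 → Ω → (Edge 3 L × NoiseIdx 2 → ℝ)) (hW : IsFlatBrownian W P)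
        (U : ℝ≥0 → Ω → GaugeConfig 3 L (Matrix.specialUnitaryGroup (Fin 2) ℂ)),
        (∀ ω, U 0 ω = x) →
        (latticeLangevinDynamics (fundamentalLatticeRep 2) β').IsSolution (fundamentalRep (Fin 2))
          hW.natFiltration P W U →
        κ t x = P.map (U t))
    {f : (Edge 3 L × Fin 2 × Fin 2 × Bool → ℝ) → ℝ} (hf : ContDiff ℝ 5 f) {M : ℝ} {t : ℝ≥0} (ht : 0 < (t : ℝ)) :
    let coords : GaugeConfig 3 L (Matrix.specialUnitaryGroup (Fin 2) ℂ) → (Edge 3 L × Fin 2 × Fin 2 × Bool → ℝ) :=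
      fun V q => (fun z : ℂ => if q.2.2.2 then z.im else z.re)
        ((fundamentalRep (Fin 2) (V q.1) : Matrix (Fin 2) (Fin 2) ℂ) q.2.1 q.2.2.1)
    let A : GaugeConfig 3 L (Matrix.specialUnitaryGroup (Fin 2) ℂ) → (Edge 3 L × Fin 2 × Fin 2 × Bool) →
        (Edge 3 L × Fin 2 × Fin 2 × Bool) → ℝ := fun V i j =>
      ∑ n : Edge 3 L × NoiseIdx 2,
        (if n.1 = i.1 then (fun z : ℂ => if i.2.2.2 then z.im else z.re)
          ((latticeLangevinDynamics (fundamentalLatticeRep 2) β').noise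
            (matrixConfig (fundamentalRep (Fin 2)) V) i.1 n.2 i.2.1 i.2.2.1) else 0) *
        (if n.1 = j.1 then (fun z : ℂ => if j.2.2.2 then z.im else z.re)
          ((latticeLangevinDynamics (fundamentalLatticeRep 2) β').noise
            (matrixConfig (fundamentalRep (Fin 2)) V) j.1 n.2 j.2.1 j.2.2.1) else 0)
    (∀ y, |f (coords y)| ≤ M) →
    ∃ g : (Edge 3 L × Fin 2 × Fin 2 × Bool → ℝ) → ℝ, ContDiff ℝ 3 g ∧ HasCompactSupport g ∧ (∀ x, ∫ y, f (coords y) ∂(κ t x) = g (coords x)) ∧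
      ∀ x₀, (∑ i : Edge 3 L × Fin 2 × Fin 2 × Bool, ∑ j : Edge 3 L × Fin 2 × Fin 2 × Bool, fderiv ℝ g (coords x₀) (Pi.single i 1) * fderiv ℝ g (coords x₀) (Pi.single j 1) * A x₀ i j) ≤ (2 * (1 - 12 * |β'|)) / (Real.exp (2 * (1 - 12 * |β'|) * (t : ℝ)) - 1) * M ^ 2 := by
  intro coords A hM
  classical
  obtain ⟨g, hg, hgc, hgrep, hb⟩ := wilson_reverseLocalPoincare_uniform L β' κ hreal t hf hβ
  refine ⟨g, hg, hgc, hgrep, fun x₀ => ?_⟩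
  haveI : IsProbabilityMeasure (κ t x₀) := IsMarkovKernel.isProbabilityMeasure x₀
  set c : ℝ := 2 * (1 - 12 * |β'|) with hc
  have hc0 : 0 < c := by rw [hc]; linarith
  have hden : 0 < Real.exp (c * (t : ℝ)) - 1 := by
    have : 1 < Real.exp (c * (t : ℝ)) := Real.one_lt_exp_iff.2 (mul_pos hc0 ht)
    linarith
  have hq : 0 < (Real.exp (c * (t : ℝ)) - 1) / c := div_pos hden hc0
  have h1 := hb x₀
  have hco : Continuous coords := continuous_coords (L := L)
  have cF : Continuous fun y : (GaugeConfig 3 L (Matrix.specialUnitaryGroup (Fin 2) ℂ)) => f (coords y) := hf.continuous.comp hco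
  have h2 : ∫ y, f (coords y) * f (coords y) ∂(κ t x₀) ≤ M ^ 2 := by
    calc ∫ y, f (coords y) * f (coords y) ∂(κ t x₀) ≤ ∫ _y, M ^ 2 ∂(κ t x₀) := by
          refine integral_mono (integrable_of_continuous_of_compactSpace (cF.mul cF) _) (integrable_const _) fun y => ?_
          have h := hM y
          have hM0 : 0 ≤ M := (abs_nonneg _).trans h
          rw [abs_le] at h
          show f (coords y) * f (coords y) ≤ M ^ 2
          nlinarith
      _ = M ^ 2 := by simp
  have h3 : 0 ≤ (∫ y, f (coords y) ∂(κ t x₀)) ^ 2 := sq_nonneg _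
  have h4 : (Real.exp (c * (t : ℝ)) - 1) / c * (∑ i : Edge 3 L × Fin 2 × Fin 2 × Bool, ∑ j : Edge 3 L × Fin 2 × Fin 2 × Bool, fderiv ℝ g (coords x₀) (Pi.single i 1) * fderiv ℝ g (coords x₀) (Pi.single j 1) * A x₀ i j) ≤ M ^ 2 := by linarith
  rw [div_mul_eq_mul_div, le_div_iff₀ hden]
  have h5 := mul_le_mul_of_nonneg_left h4 hc0.le
  have e : c * ((Real.exp (c * (t : ℝ)) - 1) / c * (∑ i : Edge 3 L × Fin 2 × Fin 2 × Bool, ∑ j : Edge 3 L × Fin 2 × Fin 2 × Bool, fderiv ℝ g (coords x₀) (Pi.single i 1) * fderiv ℝ g (coords x₀) (Pi.single j 1) * A x₀ i j)) = (∑ i : Edge 3 L × Fin 2 × Fin 2 × Bool, ∑ j : Edge 3 L × Fin 2 × Fin 2 × Bool, fderiv ℝ g (coords x₀) (Pi.single i 1) * fderiv ℝ g (coords x₀) (Pi.single j 1) * A x₀ i j) * (Real.exp (c * (t : ℝ)) - 1) := by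
    field_simp
  rw [e] at h5
  linarith

end Summit.QuantumFields.YangMills.Theorems.ColdStartUniversality
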